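import Literature.MathematicalPhysics.QuantumFieldTheory.Balaban1983to89.B2Eq268DerivHiggsRegion
import Literature.MathematicalPhysics.QuantumFieldTheory.Balaban1983to89.B2Eq268DerivBoxLayer
import Literature.MathematicalPhysics.QuantumFieldTheory.Balaban1983to89.B2Eq274DerivHiggsRegion
import Literature.MathematicalPhysics.QuantumFieldTheory.Balaban1983to89.B2Eq265HiggsRegion

/-!
# `Balaban1983to89.B2Eq266HiggsRegion` — [Balaban1982Higgs2] **Lemma 2.4 (2.66), THE DERIVATIVE CLAUSE** p. 572 («(D^η_{A^{(k)}}φ^{(k)})(b)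
# = O(p(Lᵏε)) for b ⊂ Bᵏ(Λ₇^{(k−1)′})») ON THE (Higgs)₂,₃ CARRIER OF RECORD: the (2.77) ⇒ (2.66) ASSEMBLY — «Combining the equalities
# (2.67), (2.68), (2.74), (2.76)» FOR THE COVARIANT DERIVATIVE of the typer's (2.56) `φ^{(k)} = bgScalar256`, from p23's (2.67)-for-the-
# derivative, own D4′ (2.68)-for-the-derivative (Leibniz form) + D4b′ (its boundary-layer column) at the constant field `A₀`, and own D2′∘D3′
# ((2.70)/(2.74) gauge-out + (2.76)-for-the-derivative at zero field), with every remainder explicit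

statement-level skeleton of published theorems with citation tags; proofs where landed; nothing here is a claim
about the Yang–Mills mass gap

PDF held: `paper:balaban1982-cmp86-higgs23-ii` (journal page = PDF page + 554), p. 572 [PDF 18] (Lemma 2.4, (2.65)–(2.70)), p. 573
[PDF 19] ((2.71)–(2.77)), re-read this session on the ×2 renders `run/shared/lean/pub/pub-balaban/b2b-balaban-ref1/pages/1982-cmp86-
higgs23-II/1982-cmp86-higgs23-II-p018-x2.png` / `…-p019-x2.png` and the text layer p0018/p0019.

CITATION HEADER (lean-in-tree rule).  T. Bałaban, *(Higgs)₂,₃ quantum fields in a finite volume. II. An upper bound*,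
Commun. Math. Phys. **86** (1982) 555–594, doi:10.1007/bf01214890 [Balaban1982Higgs2]; operators of part I, Commun. Math. Phys. **85**
(1982) 603–626 [Balaban1982Higgs1], kernels of part III, Commun. Math. Phys. **88** (1983) 411–445 [Balaban1983Higgs3], AS LANDED.
Cell `lit-balaban` (HOME `run/shared/lean/pub/lit-balaban/`), reader/typer seat **r14** gen 21 (B2 second reader; unit
`lit-balaban-r14-g21`; free-target protocol G.5-34(d): the derivative lane D2′/D3′/D4′/D4b′/D5 of row B2.Lem2.4 — owner r02 WELCOME
2026-08-23T07:13Z, p23 «no priority claimed» 07:20Z; TAKING line HOME/STATUS.md for this stem); SKELETON row **B2.Lem2.4** (Lemma 2.4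
(2.65)–(2.66) p. 572; fold owner r02, second reader r14; decl of record `B2.Lemma24Printed`, head `proved p250408 · p336252 · p340291 ·
p341404` UNCHANGED — cells-only member; brick D5 = the assembly of the located-residue item «the derivative clause (2.66)/(2.77)»).
Cross-references: rows **B2.Eq2.55** ((2.56) `bgScalar256`), **B1.Eq3.44**/**B1.Eq3.16** (D4′), **B3.Eq2.10** (D4′/D4b′ rows and columns),
**B1.Eq1.7**/**B1.Eq1.8** (D2′ gauge covariance).  USED BY NAME, never restated: p23's `B2Eq267HiggsRegion.eq267_deriv_higgs_region` (D1′ =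
(2.67) «and the same equality for the covariant derivative of φ^{(k)}»), own `B2Eq268DerivHiggsRegion.eq268_deriv_box` (D4′ v1.1),
`B2Eq268DerivBoxLayer.{layer_column_le, depth_le_tdist_of_mem_layer}` (D4b′), `B2Eq274DerivHiggsRegion.{eq276_deriv_const_region,
covDeriv_congr_bond, inside_of_depth}` (D2′, carrying D3′ `B2Eq276DerivHiggsRegion.eq276_deriv_zero_region`), p23's F4′
`B2Eq268HiggsRegion.{row_sums_box, bgScalar256_eq_zero_of_not_mem}`, F5 `B2Eq265HiggsRegion.{norm_covDeriv_sub_connection_le,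
norm_bgScalar256_le_row, norm_covDeriv_bgScalar256_le_col}` (the sup norms `W₀, W₁` of `φ^{(k)}_□` from the rows, verbatim), F2
`B2Eq273NeumannLocality.{bgScalar256_congr, window_of_kbox}`, F1 `B2Eq273GaugeCovariance.{constVec, constVec_apply, cornerGauge}`, p35's
`B1Ineq225RegularBox.{cellBox, isBigBlockUnion_cellBox}`, r14's `B1Eq230FluctCov.{Ix, cb}`, `B1Ineq234Concrete.{distC, tdist_self}`.

WHAT IS PRINTED (p. 572 [PDF 18], p. 573 [PDF 19]).  *«Lemma 2.4. Under the restrictions (2.55) we have φ^{(k)}(x) = (Q_k^*(A^{(k)})φ)(x) +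
O(p(Lᵏε)) for x ∈ Bᵏ(y), y ∈ Λ₇^{(k−1)′}, (2.65) (D^η_{A^{(k)}}φ^{(k)})(b) = O(p(Lᵏε)) for b ⊂ Bᵏ(Λ₇^{(k−1)′}). (2.66)»*; *«… (2.67) and
the same equality for the covariant derivative of φ^{(k)}. … (2.68) and similarly for the derivative. …»*; p. 573: *«Combining the
equalities (2.67), (2.68), (2.74), (2.76) and taking into account the equalities φ′(y) = φ(y), U(A₀(Γ_{x,y}))φ(y) = U(A^{(k)}(Γ_{x,y}))φ(y)
+ O((Lᵏε)^{κ₀}) we finally get (2.65). It was mentioned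
several times that the corresponding equalities hold for the covariant derivatives of φ^{(k)} and we have (D^η_{A^{(k)}}φ^{(k)})(b) =
U(A₀(Γ_{b₋,y}))(a_k∂^ηG_k(□, 0)Q_k^*□₁φ′)(b) + O((Lᵏε)^{κ₀}), b ⊂ □. (2.77)»* — p. 573 ENDS with (2.77) — and p. 574 [PDF 20], top:
*«Using again the similar considerations as in the proof of Lemma 2.3 we get (2.66). This ends the proof of Lemma 2.4.»* — which is ALL
print gives for the step (2.77) ⇒ (2.66) (renders p018/p019/p020; the text layer's «bcΠ-» is «b ⊂ □.»).  [v1.1 DOC-ONLY, referee ref-4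
g68 finding S-B2-g68-1 / D-g68-1: v1.0 quoted at this place, inside «…», a sentence «Now reasoning similarly as in the proof of (2.76) and
using the inequalities |φ′(y″) − φ′(y′)| ≤ O(1)p(Lᵏε) for y′, y″ ∈ □₁, we get (∂^ηG_k(□,0)Q_k^*□₁φ′)(b) = O(p(Lᵏε)), hence, finally, (2.66)»
that is NOT PRINTED — it was this file's own gloss of the argument (the bound |φ′(y″) − φ′(y′)| ≦ O(1)p(Lᵏε) IS printed on p. 573, as the
displayed line before (2.75), for the value clause); the gloss now stands outside quotation marks in THE ARGUMENT below; code byte-identical.]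

THE ARGUMENT (print's last paragraph, on the carrier; ε-lattice currency `ℓ = Lᵏε`, `κ = a_kℓ⁻²`, `m = |e|sεd(Lᵏ−1)`, `ȳ = x_k`, `b₀ =
⟨x, x + εe_μ⟩`; print's `∂^η = O(p)` ⇔ the carrier's `‖D^ε ·‖ ≤ ℓ⁻¹·O(p)`).  With `w = φ^{(k)}_□[A]`, `w₀ = φ^{(k)}_□[A₀]` and the cut field
`A″ = A1_{b⊂□} + A₀1_{b⊄□}` (F2: `φ^{(k)}_□[A] = φ^{(k)}_□[A″]`, and `D_Aw(b₀) = D_{A″}w(b₀)` since `b₀ ⊂ □`):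
`‖(D_Aφ^{(k)})(b₀)‖ ≤ ‖(D_Aφ^{(k)})(b₀) − (D_Aw)(b₀)‖ + ‖(D_{A″}w)(b₀) − (D_{A₀}w₀)(b₀)‖ + ‖(D_{A₀}w₀)(b₀)‖`.  The first term is p23's
(2.67)-for-the-derivative (two tails, `× a_kℓ⁻¹t′`); the second is D4′ at `B = A₀`, `A′ = A″ − A₀` (`|A′| ≤ s`, `δ_{A′} = δ_A` along collinear
pairs of inside bonds), whose explicit boundary-layer column is D4b′'s `≤ C₅(Π|S|)K₀^{d−1}m₀^{−d}·ε` for `x` at depth `m₀Lᵏ` — the `ε`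
cancelling D4′'s `ε⁻¹`; the third is D2′ (= (2.70)/(2.74) transport of D3′'s (2.76)-for-the-derivative at zero field):
`≤ a_kC₃ℓ⁻¹(4K₀λ + e^{−ρ/(4K₀)}t′)` — our reading of print's «the similar considerations» (p. 574): the (2.76) mechanism applied to the
derivative, using p. 573's displayed bound |φ′(y″) − φ′(y′)| ≦ O(1)p(Lᵏε) for y′, y″ ∈ □₁ (D3′'s HONEST SCOPE says the same).  The sup
norms `W₀ = a_kD₃t′`, `W₁ = κt′D₄ℓ + |e|sW₀` of `w` and `D_{A₀}w` on `□` come from F4′'s rows at the regular field `A` exactly as in F5.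

WHAT THIS FILE PROVES (kernel-checked, zero `sorry`; theorems only — NO definition, NO `Prop`-valued fact; axioms standard).
 **`eq266_higgs_region`** — LEMMA 2.4 (2.66) ON THE CARRIER with explicit remainder: F5's `eq265_higgs_region` binders word for word,
 then `(x : Site P 0) (μ : Fin P.d)` with F5's depth hypothesis, `+ (m₀ : ℕ), 1 ≤ m₀, {|z − x| ≤ Lᵏm₀} ⊂ □` (the depth feeding D4b′), F5's
 `ȳ ∈ □₁`, `φ`/`t′`/`λ`/`ρ` hypotheses (with `ρ ≤ |ȳ − y′|` for all `y′ ∉ □₁`), and the conclusion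
 `‖(D_Aφ^{(k)}[Λ₂′,Λ₆′,A,φ])(⟨x, x+εe_μ⟩)‖ ≤ a_kℓ⁻¹t′[C₁e^{−dist(x,□ᶜ)/(4K₀Lᵏ)} + C₂e^{−ρ/(4K₀)}]` `+ |e|sW₀ + D₂ℓ[κmt′ + |e|sd(2W₁ + |e|sW₀) +
 ε⁻¹|e|δ_AdW₀ + κ(2m+m²)W₀]` `+ |e|sdW₀·D₅(Π_μ|S_μ|)K₀^{d−1}m₀^{−d}` `+ a_kC₃ℓ⁻¹[4K₀λ + e^{−ρ/(4K₀)}t′]`, `W₀ = a_kD₃t′`, `W₁ = κt′D₄ℓ + |e|sW₀`.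

HONEST SCOPE / DIFFERENCES FROM PRINT (recorded, not hidden).  (a) Regions, box, window, depth: as F5 (a) — `□ = Bᵏ(□₂)` a cell-product box of
big blocks in a proper box `q + [0,S)ᵈ`, `□₁ ⊆ □₂ ⊆ Λ₂′`, `□₁ ⊆ Λ₆′ ⊆ Λ₂′`, `Bᵏ(Λ₂′)` a big-block union, `ȳ ∈ □₁`, `x` deep — PLUS the integer
depth `m₀ ≥ 1` (`{|z − x| ≤ Lᵏm₀} ⊂ □`; print: `b ⊂ Bᵏ(y)` and `□ ⊇` the blocks within `4r(Lᵏε)` of `y`, so `m₀ ≈ 4r − 1`); the boundary-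
layer term carries `(Π_μ|S_μ|)K₀^{d−1}m₀^{−d}`, bounded for print's `□` (`|S_μ| ≈ 8r/K₀ + 3`) — reading it is the final-size residue's.  (b) The
vector field: as F5 (b) (two regularity forms + `|A_b − A₀,_b| ≤ s` on the bonds of `□`); `δ_A` enters ALSO as `ε⁻¹|e|δ_A` (D4′ (b):
print's (2.60), `ε⁻¹δ_A = O(p)`), and `s` enters with coefficient `W₀` WITHOUT a factor `ℓ` (D4′ (b′): the field switch) — both `O(p)·W₀`
only through the readings of `s, δ_A` (NOT derived here).  (c) The scalar field: as F5 (c) — `|φ| ≤ t′` on `Λ₆′` and the Lipschitz modulus `λ`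
of the GAUGED field about `ȳ` on `□₁` (print's «|φ′(y″) − φ′(y′)| ≤ O(1)p(Lᵏε)» from (2.55)₃ — NOT derived here); the derivative scale: the
bound is `ℓ⁻¹ ×` [value-type sizes], print's `∂^η`-currency `O(p(Lᵏε))`.  (d) Only the bonds `b₀ = ⟨x, x + εe_μ⟩` in the positive directions
(the carrier's `PBond`; print's `b` unoriented — the other orientation is the same bond).  (e) Constants `K₀min, e₁, t, C₁…C₃, D₂…D₅` are the
cited bricks' (explicit there, not numerical); hypotheses `K₀ ∣ M`, `3LᵏK₀ ≤ |T_ε|_μ`, `Lᵏε ≤ ε₀`, `Lᵏε ≤ 1`, `1 ≤ k ≤ K`.  (f) NO mass summand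
`(m²ℓ²/(a_k+m²ℓ²))t′` and NO `Q_k^*(A₀)` vs `Q_k^*(A)` transport summand (F5's fourth and fifth): (2.66) compares `D^ηφ^{(k)}` with `0`, not
with `Q_k^*φ` — the derivative of the (2.76) main term is bounded outright by D3′ (the covariant derivative of a transported constant is the
Lipschitz modulus).  (g) NONE of the value clause's later conversions is applied here (p23's F9–F16: (2.55)-feeding `Restr255`, Lemma 2.3's
data from (2.55)₁,₂, box margins, printed thresholds, tower regions, the (2.67) tails as `O((Lᵏε)^κ)`): they act on the LETTERS of this bound
verbatim and are optional zero-weight twins.  Value = Lemma 2.4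
(2.66) now holds, with explicit remainder, for the carrier of record's own `D^ε_Aφ^{(k)}`; the located residue «the derivative clause
(2.66)/(2.77)» of row B2.Lem2.4 is closed up to reading the sizes `s, δ_A, λ, ρ, m₀, |S_μ|` from (2.55)/(2.60) and the radii; NOT summit progress.
-/

open scoped BigOperators

noncomputable section

namespace Literature.MathematicalPhysics.QuantumFieldTheory.Balaban1983to89.B2Eq266HiggsRegion

open HiggsLattice (ChargeData covDeriv)
open HiggsAveraging (blockIter toFinest)
open HiggsCovariance (propagatorK E)
open HiggsCovariancePos (Inside)
open HiggsGaugeInvariance (rot)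
open B2Eq255Concrete (bgScalar256 underRegion mem_underRegion)
open B2Eq267HiggsRegion (eq267_deriv_higgs_region)
open B2Eq268HiggsRegion (row_sums_box bgScalar256_eq_zero_of_not_mem)
open B2Eq268DerivHiggsRegion (eq268_deriv_box)
open B2Eq268DerivBoxLayer (layer_column_le depth_le_tdist_of_mem_layer)
open B2Eq274DerivHiggsRegion (eq276_deriv_const_region covDeriv_congr_bond inside_of_depth)
open B2Eq265HiggsRegion (norm_covDeriv_sub_connection_le norm_bgScalar256_le_row norm_covDeriv_bgScalar256_le_col)
open B2Eq273GaugeCovariance (constVec constVec_apply cornerGauge)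
open B2Eq273NeumannLocality (bgScalar256_congr window_of_kbox)
open B1Ineq225RegularBox (cellBox isBigBlockUnion_cellBox)
open B1Eq230FluctCov (Ix cb)
open B1Ineq234Concrete (distC tdist_self)
open B1TorusRegionHSizes (IsBigBlockUnion)
open B1TorusCubeCover (half)
open B1TorusCubeLocality26 (rS)

variable {P : HiggsLattice.Params} {N : ℕ}

/-! ## (2.66): the derivative clause of Lemma 2.4 for the carrier of record's `φ^{(k)}` -/

section Eq266

/-- `‖a‖ ≤ ‖a − b‖ + ‖b − c‖ + ‖c‖`. [folklore] -/
private theorem norm_le_three {V : Type*} [SeminormedAddCommGroup V] (a b c : V) : ‖a‖ ≤ ‖a - b‖ + ‖b - c‖ + ‖c‖ := by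
  have h1 : a = (a - b) + (b - c) + c := by abel
  calc ‖a‖ = ‖(a - b) + (b - c) + c‖ := by rw [← h1]
    _ ≤ ‖(a - b) + (b - c)‖ + ‖c‖ := norm_add_le _ _
    _ ≤ ‖a - b‖ + ‖b - c‖ + ‖c‖ := add_le_add (norm_add_le _ _) le_rfl

/-- **LEMMA 2.4 (2.66), DERIVATIVE CLAUSE, ON THE (Higgs)₂,₃ CARRIER OF RECORD** (ε-lattice currency; `ℓ = Lᵏε`, `κ = a_kℓ⁻²`,
`m = |e|sεd(Lᵏ−1)`, `ȳ = x_k`, `b₀ = ⟨x, x + εe_μ⟩`).  For `d ≥ 1`, `L ≥ 2`, `a, m² > 0`, `N`, charge data, a mesh cap `ε₀` and a regularity pair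
`(c, β)`, `β > 0`: there are `K₀min` and, per `K₀ ≥ K₀min`, thresholds `e₁, t > 0` and constants `C₁, C₂, C₃, D₂, D₃, D₄, D₅ ≥ 0` such that — on
every torus of the carrier with `K₀ ∣ M`, at every level `1 ≤ k ≤ K_P` with `3LᵏK₀ ≤ |T_ε|_μ`, `Lᵏε ≤ ε₀`, `Lᵏε ≤ 1`; for regions `Λ₆′ ⊆ Λ₂′`,
`□₁ ⊆ □₂ ⊆ Λ₂′`, `□₁ ⊆ Λ₆′` with `Bᵏ(Λ₂′)` a big-block union and `□ = Bᵏ(□₂)` a cell-product box lying in a proper box `q + [0,S)ᵈ`,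
`LᵏS < |T_ε|_μ`; for the vector field `A` (I.2.23)-regular on `Bᵏ(Λ₂′)` (coupling `0 < e_k ≤ e₁`) and on `□` (`|A(z+εe_ν,μ) − A(z,μ)| ≤ δ_A`,
`Lᵏδ_A|e| ≤ t`), within `s` of the constant field `A₀ = constVec c` on the bonds of `□`; for `x` with `{|z − x| ≤ 2r_S + 2LᵏK₀(d+1) + 1} ⊂ □`
and `{|z − x| ≤ Lᵏm₀} ⊂ □` (`m₀ ≥ 1`), `ȳ ∈ □₁`, and a direction `μ`; for `φ` with `|φ| ≤ t′` on `Λ₆′`, the gauged field `φ′ = U(λ_{q̄})φ`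
`λ`-Lipschitz about `ȳ` on `□₁`, and `ρ ≤ |ȳ − y′|` for all `y′ ∉ □₁` —
`‖(D_Aφ^{(k)})(⟨x, x+εe_μ⟩)‖ ≤ a_kℓ⁻¹t′[C₁e^{−dist(x,□ᶜ)/(4K₀Lᵏ)} + C₂e^{−ρ/(4K₀)}]` `+ |e|sW₀ + D₂ℓ[κmt′ + |e|sd(2W₁ + |e|sW₀) + ε⁻¹|e|δ_AdW₀ +
κ(2m+m²)W₀]` `+ ε⁻¹|e|sdW₀·(D₅(Π_μ|S_μ|)K₀^{d−1}m₀^{−d}ε)` `+ a_kC₃ℓ⁻¹[4K₀λ + e^{−ρ/(4K₀)}t′]`, with `W₀ = a_kD₃t′`, `W₁ = κt′D₄ℓ + |e|sW₀` —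
print's «(D^η_{A^{(k)}}φ^{(k)})(b) = O(p(Lᵏε))» with the remainder explicit, for the typer's (2.56) `φ^{(k)} = bgScalar256`.
[cite: Balaban1982Higgs2, Lemma 2.4 (2.66) p.572] [cite: Balaban1982Higgs2, Lemma 2.4 proof (2.77) p.573, p.574 «Using again the similar considerations as in the proof of Lemma 2.3 we get (2.66).»]
[cite: Balaban1982Higgs2, Lemma 2.4 proof (2.67)–(2.68) p.572 «the same equality for the covariant derivative», «similarly for the derivative»] -/
theorem eq266_higgs_region (d L : ℕ) (hd : 1 ≤ d) (hL : 2 ≤ L) {a : ℝ} (ha : 0 < a) {msq : ℝ} (hmsq : 0 < msq)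
    (N : ℕ) (C : ChargeData N) (ε₀ : ℝ) (creg β : ℝ) (hcreg : 0 ≤ creg) (hβ : 0 < β) :
    ∃ K₀min : ℕ, ∀ K₀ : ℕ, K₀min ≤ K₀ → ∃ e₁ t : ℝ, 0 < e₁ ∧ 0 < t ∧
      ∃ C₁ C₂ C₃ D₂ D₃ D₄ D₅ : ℝ, 0 ≤ C₁ ∧ 0 ≤ C₂ ∧ 0 ≤ C₃ ∧ 0 ≤ D₂ ∧ 0 ≤ D₃ ∧ 0 ≤ D₄ ∧ 0 ≤ D₅ ∧
      ∀ (P : HiggsLattice.Params), P.d = d → P.L = L → K₀ ∣ P.M →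
      ∀ {k : ℕ}, 1 ≤ k → k ≤ P.K → (∀ μ, 3 * half P k K₀ ≤ P.sitesPerDir 0 μ) → P.mesh k ≤ ε₀ → P.mesh k ≤ 1 →
      ∀ (Λ₂ Λ₆ sq₂ sq₁ : Finset (HiggsLattice.Site P k)) (S : Fin P.d → Finset ℕ) (q : HiggsLattice.Site P k) (Sbox : ℕ),
        Λ₆ ⊆ Λ₂ → sq₂ ⊆ Λ₂ → sq₁ ⊆ sq₂ → sq₁ ⊆ Λ₆ →
        IsBigBlockUnion k K₀ (underRegion k Λ₂) → underRegion k sq₂ = cellBox k K₀ S →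
        (∀ μ : Fin P.d, P.L ^ k * Sbox < P.sitesPerDir 0 μ) → (∀ y ∈ sq₂, ∀ μ : Fin P.d, (y μ - q μ).val < Sbox) →
      ∀ (A : HiggsLattice.VecField P 0) {ec : ℝ}, 0 < ec → ec ≤ e₁ →
        (∀ z ∈ underRegion k Λ₂, ∀ μ ν : Fin P.d,
            P.mesh k * |C.e| / ec * |A ⟨z.shift μ, ν⟩ - A ⟨z, ν⟩| ≤ creg * ec ^ (β - 1) / (P.L : ℝ) ^ k) →
        ∀ {δA : ℝ}, 0 ≤ δA →
          (∀ z ∈ underRegion k sq₂, ∀ μ ν : Fin P.d, |A ⟨z.shift ν, μ⟩ - A ⟨z, μ⟩| ≤ δA) →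
          (P.L : ℝ) ^ k * δA * |C.e| ≤ t →
        ∀ (c : Fin P.d → ℝ) {s : ℝ}, 0 ≤ s →
          (∀ b : HiggsLattice.PBond P 0, Inside (underRegion k sq₂) b → |A b - c b.dir| ≤ s) →
      ∀ (x : HiggsLattice.Site P 0) (μ : Fin P.d),
        (∀ z, HiggsLattice.Site.tdist x z ≤ 2 * rS P k K₀ + 2 * half P k K₀ * (P.d + 1) + 1 → z ∈ underRegion k sq₂) →
        ∀ (m₀ : ℕ), 1 ≤ m₀ → (∀ z, HiggsLattice.Site.tdist x z ≤ P.L ^ k * m₀ → z ∈ underRegion k sq₂) →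
        blockIter k x ∈ sq₁ →
      ∀ (φ : HiggsLattice.ScalarField P k N) {t' : ℝ}, 0 ≤ t' → (∀ y ∈ Λ₆, ‖φ y‖ ≤ t') →
        ∀ {lam : ℝ}, 0 ≤ lam →
          (∀ y ∈ sq₁, ‖rot C (fun y => cornerGauge (toFinest q) c (toFinest y)) φ y
              - rot C (fun y => cornerGauge (toFinest q) c (toFinest y)) φ (blockIter k x)‖
                ≤ lam * (HiggsLattice.Site.tdist (blockIter k x) y : ℝ)) →
        ∀ {ρ : ℝ}, (∀ y : HiggsLattice.Site P k, y ∉ sq₁ → ρ ≤ (HiggsLattice.Site.tdist (blockIter k x) y : ℝ)) →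
        ‖covDeriv C A (bgScalar256 C msq a k Λ₂ Λ₆ A φ) (⟨x, μ⟩ : HiggsLattice.PBond P 0)‖
          ≤ B1.aSeq a P.L k * (P.mesh k)⁻¹ * t' *
                (C₁ * Real.exp (-(1 / (4 * K₀) * (distC (underRegion k sq₂) x / (P.L : ℝ) ^ k)))
                  + C₂ * Real.exp (-(1 / (4 * K₀) * ρ)))
            + (|C.e| * s * (B1.aSeq a P.L k * D₃ * t')
              + D₂ * P.mesh k *
                (B1.aSeq a P.L k * (P.mesh k)⁻¹ ^ 2 * (|C.e| * s * P.mesh 0 * (P.d * ((P.L : ℝ) ^ k - 1))) * t'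
                  + |C.e| * s * (P.d * (2 * (B1.aSeq a P.L k * (P.mesh k)⁻¹ ^ 2 * t' * D₄ * P.mesh k
                        + |C.e| * s * (B1.aSeq a P.L k * D₃ * t')) + |C.e| * s * (B1.aSeq a P.L k * D₃ * t')))
                  + (P.mesh 0)⁻¹ * (|C.e| * δA) * (P.d * (B1.aSeq a P.L k * D₃ * t'))
                  + B1.aSeq a P.L k * (P.mesh k)⁻¹ ^ 2 *
                      ((2 * (|C.e| * s * P.mesh 0 * (P.d * ((P.L : ℝ) ^ k - 1)))
                        + (|C.e| * s * P.mesh 0 * (P.d * ((P.L : ℝ) ^ k - 1))) ^ 2) * (B1.aSeq a P.L k * D₃ * t')))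
              + (P.mesh 0)⁻¹ * (|C.e| * s) * (P.d * (B1.aSeq a P.L k * D₃ * t')) *
                  (D₅ * (∏ ν : Fin P.d, ((S ν).card : ℝ)) * (K₀ : ℝ) ^ (d - 1) * ((m₀ : ℝ) ^ d)⁻¹ * P.mesh 0))
            + B1.aSeq a P.L k * C₃ * (P.mesh k)⁻¹ * (4 * K₀ * lam + Real.exp (-(1 / (4 * K₀) * ρ)) * t') := by
  obtain ⟨K₁, h267⟩ := eq267_deriv_higgs_region d L hd hL ha hmsq N C ε₀ creg β hcreg hβ
  obtain ⟨K₂, h268⟩ := eq268_deriv_box d L hd hL ha hmsq N C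
  obtain ⟨K₃, hrows⟩ := row_sums_box d L hd hL ha hmsq N C
  obtain ⟨K₄, h276⟩ := eq276_deriv_const_region d L hd hL ha hmsq N C ε₀
  obtain ⟨K₅, hlay⟩ := layer_column_le d L hd hL ha hmsq N C
  refine ⟨max (max (max K₁ K₂) (max K₃ K₄)) K₅, fun K₀ hK₀ => ?_⟩
  have hK₁ : K₁ ≤ K₀ := (((le_max_left _ _).trans (le_max_left _ _)).trans (le_max_left _ _)).trans hK₀
  have hK₂ : K₂ ≤ K₀ := (((le_max_right _ _).trans (le_max_left _ _)).trans (le_max_left _ _)).trans hK₀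
  have hK₃ : K₃ ≤ K₀ := (((le_max_left _ _).trans (le_max_right _ _)).trans (le_max_left _ _)).trans hK₀
  have hK₄ : K₄ ≤ K₀ := (((le_max_right _ _).trans (le_max_right _ _)).trans (le_max_left _ _)).trans hK₀
  have hK₅ : K₅ ≤ K₀ := (le_max_right _ _).trans hK₀
  obtain ⟨e₁, he₁, C₁, C₂, hC₁, hC₂, h267⟩ := h267 K₀ hK₁
  obtain ⟨t₂, -, D₂, ht₂, -, hD₂, h268⟩ := h268 K₀ hK₂
  obtain ⟨t₃, D₃, D₄, ht₃, hD₃, hD₄, hrows⟩ := hrows K₀ hK₃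
  obtain ⟨C₃, hC₃, h276⟩ := h276 K₀ hK₄
  obtain ⟨t₅, D₅, ht₅, hD₅, hlay⟩ := hlay K₀ hK₅
  refine ⟨e₁, t₃, he₁, ht₃, C₁, C₂, C₃, D₂, D₃, D₄, D₅, hC₁, hC₂, hC₃, hD₂, hD₃, hD₄, hD₅, ?_⟩
  intro P hPd hPL hK₀M k hk1 hkK h3 hε h1 Λ₂ Λ₆ sq₂ sq₁ S q Sbox h62 hs2 h12 h16 hΩΛ hbox hSbox hq A ec hec hle hreg δA hδA
    hregbox ht c s hs hAc x μ hx m₀ hm₀ hxm hxsq φ t' ht0 hφ lam hlam hlip ρ hρ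
  -- names and basic facts
  have hLr : (1 : ℝ) < P.L := by rw [hPL]; exact_mod_cast (by omega : 1 < L)
  have hak : 0 ≤ B1.aSeq a P.L k := (B1.aSeq_pos ha hLr hk1).le
  set Ω := underRegion k sq₂ with hΩdef
  set o := toFinest q with hodef
  set ybar := blockIter k x with hybar
  set b₀ : HiggsLattice.PBond P 0 := ⟨x, μ⟩ with hb₀def
  have hboxU : IsBigBlockUnion k K₀ Ω := by
    have h := isBigBlockUnion_cellBox (P := P) (K := k) (K₀ := K₀) S
    rw [← hbox] at h
    exact h
  have hb₀ : Inside Ω b₀ := inside_of_depth (by omega) hx μ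
  have hφ1 : ∀ y ∈ sq₁, ‖φ y‖ ≤ t' := fun y hy => hφ y (h16 hy)
  have hφybar : ‖φ ybar‖ ≤ t' := hφ1 _ hxsq
  -- Step 1: (2.67) for the derivative (p23)
  have E1 := h267 P hPd hPL hK₀M hk1 hkK h3 hε Λ₂ Λ₆ sq₂ sq₁ h62 hs2 h12 h16 hΩΛ hboxU A hec hle hreg x μ hx φ t' ht0 hφ ρ
    (fun y _ hy1 => hρ y hy1)
  -- Step 2: the truncated field `A″ = A` on the bonds of `□`, `= A₀` elsewhere
  set A'' : HiggsLattice.VecField P 0 := fun b => if Inside Ω b then A b else constVec c b with hA''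
  have hAin : ∀ b : HiggsLattice.PBond P 0, Inside Ω b → A b = A'' b := by
    intro b hb; rw [hA'']; simp only [hb, if_true]
  set w := bgScalar256 C msq a k sq₂ sq₁ A φ with hw
  have htr : w = bgScalar256 C msq a k sq₂ sq₁ A'' φ := bgScalar256_congr C hmsq hak hkK sq₂ sq₁ h12 hAin φ
  have hsplit : A'' = (A'' - constVec c) + constVec c := (sub_add_cancel _ _).symm
  have hA's : ∀ b : HiggsLattice.PBond P 0, |(A'' - constVec c) b| ≤ s := by
    intro b
    rw [Pi.sub_apply, hA'']
    by_cases hb : Inside Ω b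
    · simp only [hb, if_true, constVec_apply]; exact hAc b hb
    · simp only [hb, if_false, sub_self, abs_zero]; exact hs
  -- the regularity of `A″ − A₀` along collinear pairs of inside bonds is that of `A`
  have hregA' : ∀ (z : HiggsLattice.Site P 0) (ν : Fin P.d), Inside Ω ⟨z, ν⟩ → Inside Ω ⟨z.shift ν, ν⟩ →
      |(A'' - constVec c) ⟨z.shift ν, ν⟩ - (A'' - constVec c) ⟨z, ν⟩| ≤ δA := by
    intro z ν h0 h1'
    have e : (A'' - constVec c) ⟨z.shift ν, ν⟩ - (A'' - constVec c) ⟨z, ν⟩ = A ⟨z.shift ν, ν⟩ - A ⟨z, ν⟩ := by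
      rw [Pi.sub_apply, Pi.sub_apply, ← hAin _ h0, ← hAin _ h1', constVec_apply, constVec_apply]
      show A ⟨z.shift ν, ν⟩ - c ν - (A ⟨z, ν⟩ - c ν) = A ⟨z.shift ν, ν⟩ - A ⟨z, ν⟩
      ring
    rw [e]
    exact hregbox z h0.1 ν ν
  -- Step 2′: the sup norms of `w` from the rows of `G_k(□, A)` at the regular field `A` (as F5)
  have hregbox' : ∀ z ∈ cellBox k K₀ S, ∀ μ ν : Fin P.d, |A ⟨z.shift ν, μ⟩ - A ⟨z, μ⟩| ≤ δA := by
    rw [← hbox]; exact hregbox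
  have hroww := hrows P hPd hPL hK₀M hk1 hkK h3 h1 S A hδA hregbox' ht
  rw [← hbox] at hroww
  set W₀ : ℝ := B1.aSeq a P.L k * D₃ * t' with hW₀
  have hW₀0 : 0 ≤ W₀ := by positivity
  have hκ0 : 0 ≤ B1.aSeq a P.L k * (P.mesh k ^ 2)⁻¹ := mul_nonneg hak (inv_nonneg.2 (sq_nonneg _))
  have hW₀b : ∀ y, ‖w y‖ ≤ W₀ := by
    intro y
    by_cases hy : y ∈ Ω
    · have h := norm_bgScalar256_le_row C h12 A msq hak φ ht0 hφ1 y
      refine h.trans ?_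
      calc B1.aSeq a P.L k * (P.mesh k ^ 2)⁻¹ * t' *
            ∑ z ∈ Ω, ∑ i : Ix N, ‖propagatorK C Ω A msq a k (cb P N 0 (z, i)) y‖
          ≤ B1.aSeq a P.L k * (P.mesh k ^ 2)⁻¹ * t' * (D₃ * P.mesh k ^ 2) :=
            mul_le_mul_of_nonneg_left ((hroww.1 y hy).1) (mul_nonneg hκ0 ht0)
        _ = W₀ := by
            have hm : P.mesh k ≠ 0 := (P.mesh_pos k).ne'
            rw [hW₀]; field_simp
    · rw [hw, bgScalar256_eq_zero_of_not_mem hmsq hak h12 A φ hy, norm_zero]; exact hW₀0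
  set W₁ : ℝ := B1.aSeq a P.L k * (P.mesh k)⁻¹ ^ 2 * t' * D₄ * P.mesh k + |C.e| * s * W₀ with hW₁
  have hW₁0 : 0 ≤ W₁ := by have := P.mesh_pos k; positivity
  have hW₁b : ∀ b : HiggsLattice.PBond P 0, Inside Ω b →
      ‖covDeriv C (constVec c) (bgScalar256 C msq a k sq₂ sq₁ ((A'' - constVec c) + constVec c) φ) b‖ ≤ W₁ := by
    intro b hb
    rw [← hsplit, ← htr]
    have h1 := norm_covDeriv_sub_connection_le C A (constVec c) w b
    have h2 := norm_covDeriv_bgScalar256_le_col C h12 A msq hak φ ht0 hφ1 b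
    have h3 : ‖covDeriv C A w b‖ ≤ B1.aSeq a P.L k * (P.mesh k)⁻¹ ^ 2 * t' * D₄ * P.mesh k := by
      refine h2.trans ?_
      rw [inv_pow]
      calc B1.aSeq a P.L k * (P.mesh k ^ 2)⁻¹ * t' *
            ∑ z ∈ Ω, ∑ i : Ix N, ‖covDeriv C A (propagatorK C Ω A msq a k (cb P N 0 (z, i))) b‖
          ≤ B1.aSeq a P.L k * (P.mesh k ^ 2)⁻¹ * t' * (D₄ * P.mesh k) :=
            mul_le_mul_of_nonneg_left (hroww.2 b hb) (mul_nonneg hκ0 ht0)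
        _ = B1.aSeq a P.L k * (P.mesh k ^ 2)⁻¹ * t' * D₄ * P.mesh k := by ring
    have h4 : |C.e| * |A b - constVec c b| * ‖w b.tgt‖ ≤ |C.e| * s * W₀ := by
      have hs' : |A b - constVec c b| ≤ s := by rw [constVec_apply]; exact hAc b hb
      exact mul_le_mul (mul_le_mul_of_nonneg_left hs' (abs_nonneg _)) (hW₀b _) (norm_nonneg _)
        (mul_nonneg (abs_nonneg _) hs)
    rw [hW₁]
    linarith
  -- Step 3: (2.68) for the derivative at `B = A₀ = constVec c` (D4′)
  have hregc : ∀ z ∈ Ω, ∀ μ ν : Fin P.d,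
      |constVec c ⟨z.shift ν, μ⟩ - constVec c ⟨z, μ⟩| ≤ 0 := by
    intro z _ μ ν; simp [constVec_apply]
  have htc : (P.L : ℝ) ^ k * 0 * |C.e| ≤ t₂ := by rw [mul_zero, zero_mul]; exact ht₂.le
  have hW₀b' : ∀ y, ‖bgScalar256 C msq a k sq₂ sq₁ ((A'' - constVec c) + constVec c) φ y‖ ≤ W₀ := by
    intro y; rw [← hsplit, ← htr]; exact hW₀b y
  have E2 := h268 P hPd hPL hK₀M hk1 hkK h3 h1 S sq₂ sq₁ hbox h12 (constVec c) le_rfl hregc htc (A'' - constVec c) hs hA's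
    hδA hregA' φ ht0 hφ1 hW₀b' hW₁0 hW₁b b₀ hb₀
  rw [← hsplit, ← htr] at E2
  -- `D_Aw(b₀) = D_{A″}w(b₀)` on the inside bond `b₀`
  have hDA : covDeriv C A w b₀ = covDeriv C A'' w b₀ := covDeriv_congr_bond C w (hAin b₀ hb₀)
  -- Step 4: the boundary-layer column (D4b′) at depth `m₀Lᵏ`
  have hregc' : ∀ z ∈ cellBox k K₀ S, ∀ μ ν : Fin P.d,
      |constVec c ⟨z.shift ν, μ⟩ - constVec c ⟨z, μ⟩| ≤ 0 := by
    intro z _ μ ν; simp [constVec_apply]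
  have htc' : (P.L : ℝ) ^ k * 0 * |C.e| ≤ t₅ := by rw [mul_zero, zero_mul]; exact ht₅.le
  have hb₀' : Inside (cellBox k K₀ S) b₀ := by rw [← hbox]; exact hb₀
  have hm₀r : (0 : ℝ) < (m₀ : ℝ) := by exact_mod_cast hm₀
  have hfar : ∀ y ∈ (cellBox k K₀ S).filter
      (fun y => ∃ ν : Fin P.d, y.shift ν ∉ cellBox k K₀ S ∨ y.unshift ν ∉ cellBox k K₀ S),
      (m₀ : ℝ) * (P.L : ℝ) ^ k ≤ (HiggsLattice.Site.tdist b₀.src y : ℝ) := by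
    intro y hy
    have hxm' : ∀ z, HiggsLattice.Site.tdist x z ≤ P.L ^ k * m₀ → z ∈ cellBox k K₀ S := by rw [← hbox]; exact hxm
    have h := depth_le_tdist_of_mem_layer (cellBox k K₀ S) hxm' hy
    have h' : ((P.L ^ k * m₀ : ℕ) : ℝ) ≤ (HiggsLattice.Site.tdist x y : ℝ) := by exact_mod_cast h
    push_cast at h'
    show (m₀ : ℝ) * (P.L : ℝ) ^ k ≤ (HiggsLattice.Site.tdist x y : ℝ)
    linarith
  have E4 := hlay P hPd hPL hK₀M hk1 hkK h3 h1 S (constVec c) le_rfl hregc' htc' b₀ hb₀' hm₀r hfar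
  rw [← hbox] at E4
  -- Step 5: (2.74)/(2.76) for the derivative at the constant field (D2′ ∘ D3′)
  have hwin := window_of_kbox (P := P) hkK q Sbox hSbox sq₂ hq
  have E5 := h276 P hPd hPL hK₀M hk1 hkK h3 hε sq₂ sq₁ h12 hboxU o hwin c x μ hx φ lam hlam hlip ρ (fun y _ hy1 => hρ y hy1)
  -- assembly
  have htri := norm_le_three (covDeriv C A (bgScalar256 C msq a k Λ₂ Λ₆ A φ) b₀) (covDeriv C A w b₀)
    (covDeriv C (constVec c) (bgScalar256 C msq a k sq₂ sq₁ (constVec c) φ) b₀)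
  rw [hDA] at htri E1
  have hes : 0 ≤ |C.e| * s := mul_nonneg (abs_nonneg _) hs
  have hεi : 0 ≤ (P.mesh 0)⁻¹ := inv_nonneg.2 (P.mesh_pos 0).le
  have hlaycoef : 0 ≤ (P.mesh 0)⁻¹ * (|C.e| * s) * (P.d * W₀) := by positivity
  have E2' := E2.trans (add_le_add le_rfl (mul_le_mul_of_nonneg_left E4 hlaycoef))
  have E5' : ‖covDeriv C (constVec c) (bgScalar256 C msq a k sq₂ sq₁ (constVec c) φ) b₀‖
      ≤ B1.aSeq a P.L k * C₃ * (P.mesh k)⁻¹ * (4 * K₀ * lam + Real.exp (-(1 / (4 * K₀) * ρ)) * t') := by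
    refine E5.trans (mul_le_mul_of_nonneg_left ?_ ?_)
    · exact add_le_add le_rfl (mul_le_mul_of_nonneg_left hφybar (Real.exp_nonneg _))
    · have := P.mesh_pos k; positivity
  have hsum := add_le_add (add_le_add E1 E2') E5'
  refine htri.trans (hsum.trans (le_of_eq ?_))
  rw [hW₁, hW₀]

end Eq266

end Literature.MathematicalPhysics.QuantumFieldTheory.Balaban1983to89.B2Eq266HiggsRegion

end
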